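import Mathlib
import HarnessLib
import Literature.Analysis.FluidPDE.ClassicalSolution
import Literature.Analysis.FluidPDE.LerayHopf
import Literature.Analysis.FluidPDE.SuitableWeak
import Summits.NavierStokesRegularity.NavierStokesRegularity.Theorems.QuarterJoltSliceTestIncrement
import Summits.NavierStokesRegularity.NavierStokesRegularity.Theorems.QuarterJoltEnergyJumpLaw
import Summits.NavierStokesRegularity.NavierStokesRegularity.Theorems.QuarterJoltEnergyJumpDefect
import Summits.NavierStokesRegularity.NavierStokesRegularity.Theorems.CertifiedBlowupCertifiedBlowupAxisymBlowupEnergyDrain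

/-!
# Route QuarterJolt — crux `NoTerminalJolt` (stmt-NavierStokesRegularity-26463), LEAD line
# `regular_split` rev 5: A TYPE-I BLOW-UP HAS NO ENERGY JUMP

Seat ns-ntj-p1 g4 (LEAD of the crux; `--supports 26463 --as helper`). Last file of the TYPE-I ENERGY
EQUALITY chain (`QuarterJoltSliceTestTransport` p638099 → `QuarterJoltSliceTestStatic` p638481 →
`QuarterJoltSliceTestIncrement` → THIS). Frame: `(u,p)` classical on `[0,T)` (`ν, T > 0`), Leray–Hopf
on `[0,T]` from a rapidly decaying datum.

THE THEOREM (`tendsto_integral_norm_sub_sq_of_isTypeIBlowup`): under the sup-norm Type-I rate at `T`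
(`IsTypeIBlowup u T`), `∫‖u(t) − u(T)‖² → 0` as `t ↑ T` — equivalently the energy is continuous at `T`
(`energyContinuous_of_isTypeIBlowup`), equivalently LERAY'S ENERGY EQUALITY holds on the closed
interval `[0,T]` (`energyEquality_of_isTypeIBlowup`): NO ANOMALOUS DISSIPATION AT A TYPE-I FIRST
BLOW-UP TIME. In print: T. M. Leslie, R. Shvydkoy, *The energy measure for the Euler and Navier–Stokes
equations*, ARMA 230 (2018) Thm. 1.2 (via the energy measure: Type I in time ⇒ Type I in space,
Prop. 3.2/4.2 — in the tree as `leslieShvydkoy2018_morreyBound_holds` — and `𝓗¹(Σ_T) = 0`);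
A. Cheskidov, X. Luo, Nonlinearity 33 (2020) Cor. 1.2 (weak-in-time Onsager spaces). HERE by an
elementary argument special to the first-blow-up frame (slice testing):

1. `typeI_terminalApproach_le` — THE TYPE-I TERMINAL APPROACH LAW: for `t ∈ (0,T)` with the rate on
   `(t,T)`, `∫‖u(t) − u(T)‖² ≤ (ν/2)·w + 4C√(2E₀)·√w`, `w = (T−t)·∫|Du(t)|²_F` the SCALE-FREE
   ENSTROPHY (`‖a−b‖² = 2⟨a−b,a⟩ − (‖a‖²−‖b‖²)`; `sliceTest_terminal_abs_le` with `η = 2`; the energy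
   drop absorbs the dissipation, `EnergyDrain.dissipation_le_energy_sub`).
2. `frequently_scaleFreeEnstrophy_lt` — finite dissipation forces `w(t) < ε` at times arbitrarily
   close to `T` (no Type-I hypothesis).
3. The limit of `∫‖u(t) − u(T)‖²` exists (`exists_energyJump`, p632054), hence it is `0`.

BY-PRODUCTS and the POSITION for the skeleton rev 5 (18118's conclusion at Type-I blow-ups; a
Type-I first blow-up is a jump-free jolt; stub `stub_typeIIEnergyEquality` ⟺ «no energy jump at ANY
first blow-up of the frame») are in the companion file `QuarterJoltTypeIEnergyEqualityPosition.lean`.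
HONEST FRAMING: no Type-I blow-up is known to exist (stmt-1217 says none does); nothing here claims
progress on `NoTerminalJolt`, `NoTypeIBlowup` or Navier–Stokes regularity, all OPEN. [folklore]
-/

noncomputable section

-- the summit and its single sub-problem share the name (CONVENTIONS §1), as in every Theorems file
set_option linter.dupNamespace false

namespace Summit.NavierStokesRegularity.NavierStokesRegularity.Theorems

open MeasureTheory Set Function Filter Topology InnerProductSpace
open scoped ENNReal NNReal ContDiff RealInnerProductSpace
open Literature.Analysis.FluidPDE

namespace NoTerminalJolt

/-! ### Tool -/

/-- `ofReal (∫ g) ≤ ∫⁻ ofReal g` for every real function (no integrability needed: a non-integrable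
`g` has integral `0`). [folklore] -/
private theorem ofReal_integral_le_lintegral_ofReal_aux {α : Type*} [MeasurableSpace α]
    {μ : Measure α} (g : α → ℝ) :
    ENNReal.ofReal (∫ x, g x ∂μ) ≤ ∫⁻ x, ENNReal.ofReal (g x) ∂μ := by
  by_cases hgi : Integrable g μ
  · have hmax : ∀ x, ENNReal.ofReal (max (g x) 0) = ENNReal.ofReal (g x) := by
      intro x
      rcases le_total (g x) 0 with hx | hx
      · rw [max_eq_right hx, ENNReal.ofReal_zero, ENNReal.ofReal_of_nonpos hx]
      · rw [max_eq_left hx]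
    calc ENNReal.ofReal (∫ x, g x ∂μ) ≤ ENNReal.ofReal (∫ x, max (g x) 0 ∂μ) :=
          ENNReal.ofReal_le_ofReal (integral_mono hgi hgi.pos_part fun x => le_max_left _ _)
      _ = ∫⁻ x, ENNReal.ofReal (max (g x) 0) ∂μ :=
          ofReal_integral_eq_lintegral_ofReal hgi.pos_part (Eventually.of_forall fun x => le_max_right _ _)
      _ = ∫⁻ x, ENNReal.ofReal (g x) ∂μ := lintegral_congr hmax
  · rw [integral_undef hgi, ENNReal.ofReal_zero]; exact bot_le

/-! ### THE TYPE-I TERMINAL APPROACH LAW -/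

/-- **THE TYPE-I TERMINAL APPROACH LAW.** `(u,p)` classical on `[0,T)` (`ν, T > 0`), Leray–Hopf on
`[0,T]` from a rapidly decaying datum, `t ∈ (0,T)`, and the sup-norm Type-I rate
`‖u(τ,x)‖ ≤ C/√(T−τ)` on `(t,T)` (`C ≥ 0`). Then, with the SCALE-FREE ENSTROPHY `w = (T−t)·∫|Du(t)|²_F`
and `E₀ = E(u 0)`:
`∫‖u(t) − u(T)‖² ≤ (ν/2)·w + 4C·√(2E₀)·√w`.
Proof: `‖a−b‖² = 2⟨a−b, a⟩ − (‖a‖² − ‖b‖²)` with `a = u(t)`, `b = u(T)`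
(`integral_norm_sub_sq_terminal_eq`); the slice-test increment `sliceTest_terminal_abs_le` with
`η = 2` bounds `2|⟨u(T) − u(t), u(t)⟩|` by `2ν∫ₜᵀ∫|Du|²_F + (ν/2) w + 4C√(2E₀)√w`, and the energy drop
`∫‖u(t)‖² − ∫‖u(T)‖² ≥ 2ν∫ₜᵀ∫|Du|²_F` (`EnergyDrain.dissipation_le_energy_sub`, the terminal time
included) cancels the dissipation. In words: AT A TYPE-I BLOW-UP THE `L²` DISTANCE TO THE TERMINAL VALUE
IS CONTROLLED BY THE SCALE-FREE ENSTROPHY `(T−t)‖∇u(t)‖₂²`. [folklore] -/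
theorem typeI_terminalApproach_le {ν T : ℝ} (hν : 0 < ν) (hT : 0 < T)
    {u : ℝ → EuclideanSpace ℝ (Fin 3) → EuclideanSpace ℝ (Fin 3)} {p : ℝ → EuclideanSpace ℝ (Fin 3) → ℝ}
    (hcl : IsClassicalNSSolutionOn (Ico 0 T) ν 0 u p) (hLH : IsLerayHopfOn T ν 0 (u 0) u)
    (hdec : HasRapidSpatialDecay (u 0))
    {C : ℝ} (hC : 0 ≤ C) {t : ℝ} (ht : t ∈ Ioo 0 T)
    (hTI : ∀ τ ∈ Ioo t T, ∀ x, ‖u τ x‖ ≤ C / Real.sqrt (T - τ)) :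
    ∫ x, ‖u t x - u T x‖ ^ 2 ≤
      ν / 2 * ((T - t) * ∫ x, frobeniusNormSq (fderiv ℝ (u t) x)) +
        4 * C * Real.sqrt (2 * VectorCalculus.kineticEnergy (u 0)) *
          Real.sqrt ((T - t) * ∫ x, frobeniusNormSq (fderiv ℝ (u t) x)) := by
  set Z : ℝ := ∫ x, frobeniusNormSq (fderiv ℝ (u t) x) with hZ
  have hZ0 : 0 ≤ Z := integral_nonneg fun x => frobeniusNormSq_nonneg _
  have hTt : 0 ≤ T - t := sub_nonneg.2 ht.2.le
  obtain ⟨-, hDle⟩ := CertifiedBlowupAxisymBlowup.EnergyDrain.dissipation_le_energy_sub hν hcl hLH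
    ht.1.le ht.2.le le_rfl
  have h := sliceTest_terminal_abs_le hν hT hcl hLH hdec hC ht hTI (by norm_num : (0:ℝ) < 2)
  have hid := integral_norm_sub_sq_terminal_eq hT hLH ⟨ht.1.le, ht.2.le⟩
  have hcomm : ∫ x, ⟪u t x, u T x⟫ = ∫ x, ⟪u T x, u t x⟫ :=
    integral_congr_ae (Eventually.of_forall fun x => real_inner_comm _ _)
  have hEt : ∫ x, ‖u t x‖ ^ 2 = 2 * VectorCalculus.kineticEnergy (u t) := by
    simp only [VectorCalculus.kineticEnergy]; ring
  have hET : ∫ x, ‖u T x‖ ^ 2 = 2 * VectorCalculus.kineticEnergy (u T) := by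
    simp only [VectorCalculus.kineticEnergy]; ring
  have hsqrt : Real.sqrt Z * Real.sqrt (T - t) = Real.sqrt ((T - t) * Z) := by
    rw [Real.sqrt_mul hTt, mul_comm]
  obtain ⟨hlo, -⟩ := abs_le.1 h
  have e1 : ν / 2 * (2 : ℝ) = ν := by ring
  have e2 : ν / 2 * (2 : ℝ)⁻¹ * Z * (T - t) = ν / 4 * ((T - t) * Z) := by ring
  have e3 : Real.sqrt (2 * VectorCalculus.kineticEnergy (u 0)) * Real.sqrt Z *
      (2 * C * Real.sqrt (T - t)) =
      2 * C * Real.sqrt (2 * VectorCalculus.kineticEnergy (u 0)) * Real.sqrt ((T - t) * Z) := by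
    rw [← hsqrt]; ring
  rw [e1, e2, e3] at hlo
  rw [hid, hcomm, hEt, hET]
  linarith

/-! ### The scale-free enstrophy is small along a sequence of times -/

/-- **Finite dissipation ⇒ the scale-free enstrophy `(T−t)∫|Du(t)|²_F` is small at times arbitrarily
close to `T`.** In the frame (classical on `[0,T)`, `ν > 0`, Leray–Hopf on `[0,T]` from `u 0`; no
decay and no blow-up hypothesis): for every `ε > 0`, `(T−t)·∫|Du(t)|²_F < ε` frequently as `t ↑ T`.
Proof: otherwise `∫|Du(τ)|²_F ≥ ε/(T−τ) ≥ ε/(T−b)` on `(b,(b+T)/2)`, so the dissipation over this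
window is `≥ ε/2`, while by the energy-jump law (`exists_energyJump`) and
`EnergyDrain.dissipation_le_energy_sub` it is `≤ (e(b) − J)/(2ν) → 0` (`e(b) = ∫‖u(b)‖² − ∫‖u(T)‖²`,
`J` the energy jump). [folklore] -/
theorem frequently_scaleFreeEnstrophy_lt {ν T : ℝ} (hν : 0 < ν) (hT : 0 < T)
    {u : ℝ → EuclideanSpace ℝ (Fin 3) → EuclideanSpace ℝ (Fin 3)} {p : ℝ → EuclideanSpace ℝ (Fin 3) → ℝ}
    (hcl : IsClassicalNSSolutionOn (Ico 0 T) ν 0 u p) (hLH : IsLerayHopfOn T ν 0 (u 0) u)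
    {ε : ℝ} (hε : 0 < ε) :
    ∃ᶠ t in 𝓝[<] T, (T - t) * ∫ x, frobeniusNormSq (fderiv ℝ (u t) x) < ε := by
  obtain ⟨J, -, hJle, hlimE, -⟩ := exists_energyJump hν hT hcl hLH
  by_contra hcon
  rw [Filter.not_frequently] at hcon
  obtain ⟨a, haT, ha⟩ := mem_nhdsLT_iff_exists_Ioo_subset.1 hcon
  have hνε : 0 < ν * ε := mul_pos hν hε
  have hclose : ∀ᶠ b in 𝓝[<] T, (∫ x, ‖u b x‖ ^ 2) - ∫ x, ‖u T x‖ ^ 2 < J + ν * ε :=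
    hlimE.eventually (gt_mem_nhds (by linarith))
  have hbset : ∀ᶠ b in 𝓝[<] T, b ∈ Ioo (max a 0) T := Ioo_mem_nhdsLT (max_lt haT hT)
  obtain ⟨b, hb1, hb2⟩ := (hclose.and hbset).exists
  have hab : a < b := (le_max_left a 0).trans_lt hb2.1
  have hb0 : 0 < b := (le_max_right a 0).trans_lt hb2.1
  have hbT : b < T := hb2.2
  set s : ℝ := (b + T) / 2 with hs
  have hbs : b < s := by rw [hs]; linarith
  have hsT : s < T := by rw [hs]; linarith
  set F : ℝ → ℝ≥0∞ := fun τ => ∫⁻ x, ENNReal.ofReal (frobeniusNormSq (fderiv ℝ (u τ) x)) with hF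
  obtain ⟨hDfin, hDle⟩ := CertifiedBlowupAxisymBlowup.EnergyDrain.dissipation_le_energy_sub hν hcl
    hLH hb0.le hbs.le hsT.le
  -- upper bound: `ν D ≤ E(u b) − E(u s) ≤ (e(b) − J)/2 < ν ε/2`
  have hJs : J ≤ (∫ x, ‖u s x‖ ^ 2) - ∫ x, ‖u T x‖ ^ 2 := hJle s ⟨(hb0.trans hbs).le, hsT⟩
  have hEb : ∫ x, ‖u b x‖ ^ 2 = 2 * VectorCalculus.kineticEnergy (u b) := by
    simp only [VectorCalculus.kineticEnergy]; ring
  have hEs : ∫ x, ‖u s x‖ ^ 2 = 2 * VectorCalculus.kineticEnergy (u s) := by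
    simp only [VectorCalculus.kineticEnergy]; ring
  have hup : ν * (∫⁻ τ in Ioo b s, F τ).toReal < ν * (ε / 2) := by
    simp only [hF]
    linarith
  -- lower bound: `F τ ≥ ε/(T−b)` on `(b,s)`, so `D ≥ ε/2`
  have hTb : 0 < T - b := sub_pos.2 hbT
  have hlow_pt : ∀ τ ∈ Ioo b s, ENNReal.ofReal (ε / (T - b)) ≤ F τ := by
    intro τ hτ
    have hτa : τ ∈ Ioo a T := ⟨hab.trans hτ.1, hτ.2.trans hsT⟩
    have hge : ε ≤ (T - τ) * ∫ x, frobeniusNormSq (fderiv ℝ (u τ) x) := not_lt.1 (ha hτa)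
    have hZ0 : 0 ≤ ∫ x, frobeniusNormSq (fderiv ℝ (u τ) x) :=
      integral_nonneg fun x => frobeniusNormSq_nonneg _
    have hTτ : T - τ ≤ T - b := by linarith [hτ.1]
    have hge' : ε ≤ (T - b) * ∫ x, frobeniusNormSq (fderiv ℝ (u τ) x) :=
      hge.trans (mul_le_mul_of_nonneg_right hTτ hZ0)
    have hdiv : ε / (T - b) ≤ ∫ x, frobeniusNormSq (fderiv ℝ (u τ) x) := by
      rw [div_le_iff₀ hTb]; linarith
    exact (ENNReal.ofReal_le_ofReal hdiv).trans (ofReal_integral_le_lintegral_ofReal_aux _)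
  have hlow : ENNReal.ofReal (ε / 2) ≤ ∫⁻ τ in Ioo b s, F τ := by
    have h1 : ∫⁻ _ in Ioo b s, ENNReal.ofReal (ε / (T - b)) ≤ ∫⁻ τ in Ioo b s, F τ :=
      setLIntegral_mono' measurableSet_Ioo fun τ hτ => hlow_pt τ hτ
    rw [lintegral_const, Measure.restrict_apply MeasurableSet.univ, univ_inter, Real.volume_Ioo,
      ← ENNReal.ofReal_mul (div_nonneg hε.le hTb.le)] at h1
    have h2 : ε / (T - b) * (s - b) = ε / 2 := by
      rw [hs]; field_simp; ring
    rwa [h2] at h1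
  have hlow' : ε / 2 ≤ (∫⁻ τ in Ioo b s, F τ).toReal := by
    have := (ENNReal.ofReal_le_iff_le_toReal hDfin).1 hlow
    exact this
  have : ν * (ε / 2) ≤ ν * (∫⁻ τ in Ioo b s, F τ).toReal := mul_le_mul_of_nonneg_left hlow' hν.le
  linarith

/-! ### TYPE-I ⇒ NO ENERGY JUMP (Leslie–Shvydkoy 2018 Thm 1.2 in the frame, elementary proof) -/

/-- **TYPE-I BLOW-UP HAS NO ENERGY JUMP** (frame version of Leslie–Shvydkoy, *The energy measure for the
Euler and Navier–Stokes equations*, ARMA 230 (2018), Thm. 1.2; also Cheskidov–Luo, Nonlinearity 33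
(2020), Cor. 1.2 — both with different proofs: energy measure / weak-in-time Onsager spaces). Let
`(u,p)` be classical on `[0,T)` (`ν, T > 0`), Leray–Hopf on `[0,T]` from a rapidly decaying datum, with
the sup-norm Type-I rate at `T` (`IsTypeIBlowup u T`: `‖u(t,x)‖ ≤ C/√(T−t)` for `t < T` near `T`).
Then the trajectory is strongly `L²`-continuous into `T`: `∫‖u(t) − u(T)‖² → 0` as `t ↑ T`.
Proof: the limit `J` exists (`exists_energyJump`); by the Type-I terminal approach law and
`frequently_scaleFreeEnstrophy_lt` the distance is `< δ` frequently, for every `δ > 0`; so `J = 0`.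
(`T` need not be a blow-up time: at a regular time the hypothesis holds trivially and so does the
conclusion.) [folklore] -/
theorem tendsto_integral_norm_sub_sq_of_isTypeIBlowup {ν T : ℝ} (hν : 0 < ν) (hT : 0 < T)
    {u : ℝ → EuclideanSpace ℝ (Fin 3) → EuclideanSpace ℝ (Fin 3)} {p : ℝ → EuclideanSpace ℝ (Fin 3) → ℝ}
    (hcl : IsClassicalNSSolutionOn (Ico 0 T) ν 0 u p) (hLH : IsLerayHopfOn T ν 0 (u 0) u)
    (hdec : HasRapidSpatialDecay (u 0)) (hTI : IsTypeIBlowup u T) :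
    Tendsto (fun t => ∫ x, ‖u t x - u T x‖ ^ 2) (𝓝[<] T) (𝓝 0) := by
  obtain ⟨C, hC⟩ := hTI
  obtain ⟨J, hJ0, -, -, hlim⟩ := exists_energyJump hν hT hcl hLH
  -- a nonnegative Type-I constant and an interval on which the rate holds
  set C' : ℝ := max C 0 with hC'
  have hC'0 : 0 ≤ C' := le_max_right _ _
  obtain ⟨a, haT, ha⟩ := mem_nhdsLT_iff_exists_Ioo_subset.1 hC
  have hrate : ∀ τ ∈ Ioo (max a 0) T, ∀ x, ‖u τ x‖ ≤ C' / Real.sqrt (T - τ) := by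
    intro τ hτ x
    have h1 : ‖u τ x‖ ≤ C / Real.sqrt (T - τ) := ha ⟨(le_max_left a 0).trans_lt hτ.1, hτ.2⟩ x
    exact h1.trans (div_le_div_of_nonneg_right (le_max_left _ _) (Real.sqrt_nonneg _))
  set E₀ : ℝ := VectorCalculus.kineticEnergy (u 0) with hE₀
  set K : ℝ := ν / 2 + 4 * C' * Real.sqrt (2 * E₀) with hK
  have hK0 : 0 < K := by
    have : 0 ≤ 4 * C' * Real.sqrt (2 * E₀) := by positivity
    rw [hK]; linarith
  -- `J ≤ δ` for every `δ > 0`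
  have hJδ : ∀ δ : ℝ, 0 < δ → J ≤ δ := by
    intro δ hδ
    set ε : ℝ := min 1 ((δ / (K + 1)) ^ 2) with hε
    have hε0 : 0 < ε := lt_min one_pos (by positivity)
    have hε1 : ε ≤ 1 := min_le_left _ _
    have hsqε : Real.sqrt ε ≤ δ / (K + 1) := by
      calc Real.sqrt ε ≤ Real.sqrt ((δ / (K + 1)) ^ 2) := Real.sqrt_le_sqrt (min_le_right _ _)
        _ = δ / (K + 1) := Real.sqrt_sq (by positivity)
    have hfreq := frequently_scaleFreeEnstrophy_lt hν hT hcl hLH hε0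
    have hwin : ∀ᶠ t in 𝓝[<] T, t ∈ Ioo (max a 0) T := Ioo_mem_nhdsLT (max_lt haT hT)
    -- frequently the distance is `< δ`
    have hsmall : ∃ᶠ t in 𝓝[<] T, ∫ x, ‖u t x - u T x‖ ^ 2 < δ := by
      refine (hfreq.and_eventually hwin).mono fun t ⟨hw, htI⟩ => ?_
      have ht : t ∈ Ioo 0 T := ⟨(le_max_right a 0).trans_lt htI.1, htI.2⟩
      have hTI' : ∀ τ ∈ Ioo t T, ∀ x, ‖u τ x‖ ≤ C' / Real.sqrt (T - τ) := fun τ hτ x =>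
        hrate τ ⟨htI.1.trans hτ.1, hτ.2⟩ x
      have happ := typeI_terminalApproach_le hν hT hcl hLH hdec hC'0 ht hTI'
      set w : ℝ := (T - t) * ∫ x, frobeniusNormSq (fderiv ℝ (u t) x) with hwdef
      have hw0 : 0 ≤ w := mul_nonneg (sub_nonneg.2 ht.2.le)
        (integral_nonneg fun x => frobeniusNormSq_nonneg _)
      have hw1 : w ≤ 1 := (hw.le).trans hε1
      have hsw : Real.sqrt w ≤ Real.sqrt ε := Real.sqrt_le_sqrt hw.le
      have hwsq : w ≤ Real.sqrt w := by
        have h1 : Real.sqrt w * Real.sqrt w = w := Real.mul_self_sqrt hw0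
        have h2 : Real.sqrt w ≤ 1 := by rw [← Real.sqrt_one]; exact Real.sqrt_le_sqrt hw1
        nlinarith [Real.sqrt_nonneg w]
      have hb : ν / 2 * w + 4 * C' * Real.sqrt (2 * E₀) * Real.sqrt w ≤ K * Real.sqrt w := by
        rw [hK, add_mul]
        have : ν / 2 * w ≤ ν / 2 * Real.sqrt w := mul_le_mul_of_nonneg_left hwsq (by positivity)
        linarith
      have hKs : K * Real.sqrt w ≤ K * (δ / (K + 1)) :=
        mul_le_mul_of_nonneg_left (hsw.trans hsqε) hK0.le
      have hlt : K * (δ / (K + 1)) < δ := by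
        rw [mul_div_assoc']
        rw [div_lt_iff₀ (by linarith)]
        nlinarith
      simp only [hwdef] at hb
      linarith
    -- hence `J ≤ δ`
    by_contra hJ
    push Not at hJ
    have hev : ∀ᶠ t in 𝓝[<] T, δ < ∫ x, ‖u t x - u T x‖ ^ 2 := hlim.eventually (lt_mem_nhds hJ)
    obtain ⟨t, h1, h2⟩ := (hsmall.and_eventually hev).exists
    exact absurd h1 (not_lt.2 h2.le)
  have hJ : J = 0 := le_antisymm (le_of_forall_pos_le_add fun δ hδ => by
    simpa using hJδ δ hδ) hJ0
  rw [hJ] at hlim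
  exact hlim

/-- **Type-I blow-up has no energy jump, `eLpNorm` form** (the conclusion shape of stub
`stub_typeIIEnergyEquality` of `Cruxes/NoTerminalJolt/Lines/regular_split.lean`): under the Type-I rate
at `T`, `‖u(t) − u(T)‖_{L²} → 0` as `t ↑ T`. [folklore] -/
theorem tendsto_eLpNorm_sub_of_isTypeIBlowup {ν T : ℝ} (hν : 0 < ν) (hT : 0 < T)
    {u : ℝ → EuclideanSpace ℝ (Fin 3) → EuclideanSpace ℝ (Fin 3)} {p : ℝ → EuclideanSpace ℝ (Fin 3) → ℝ}
    (hcl : IsClassicalNSSolutionOn (Ico 0 T) ν 0 u p) (hLH : IsLerayHopfOn T ν 0 (u 0) u)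
    (hdec : HasRapidSpatialDecay (u 0)) (hTI : IsTypeIBlowup u T) :
    Tendsto (fun t => eLpNorm (u t - u T) 2 volume) (𝓝[<] T) (𝓝 0) :=
  (tendsto_eLpNorm_sub_iff_tendsto_integral_norm_sub_sq hT hLH).2
    (tendsto_integral_norm_sub_sq_of_isTypeIBlowup hν hT hcl hLH hdec hTI)

/-- **Type-I blow-up: the energy is continuous at `T`** (`∫‖u(t)‖² → ∫‖u(T)‖²` as `t ↑ T`; Radon–Riesz
in the Leray–Hopf class, `tendsto_integral_norm_sq_iff_tendsto_integral_norm_sub_sq`). [folklore] -/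
theorem energyContinuous_of_isTypeIBlowup {ν T : ℝ} (hν : 0 < ν) (hT : 0 < T)
    {u : ℝ → EuclideanSpace ℝ (Fin 3) → EuclideanSpace ℝ (Fin 3)} {p : ℝ → EuclideanSpace ℝ (Fin 3) → ℝ}
    (hcl : IsClassicalNSSolutionOn (Ico 0 T) ν 0 u p) (hLH : IsLerayHopfOn T ν 0 (u 0) u)
    (hdec : HasRapidSpatialDecay (u 0)) (hTI : IsTypeIBlowup u T) :
    Tendsto (fun t => ∫ x, ‖u t x‖ ^ 2) (𝓝[<] T) (𝓝 (∫ x, ‖u T x‖ ^ 2)) :=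
  (tendsto_integral_norm_sq_iff_tendsto_integral_norm_sub_sq hT hLH).2
    (tendsto_integral_norm_sub_sq_of_isTypeIBlowup hν hT hcl hLH hdec hTI)

/-- **Type-I blow-up satisfies LERAY'S ENERGY EQUALITY on the closed interval `[0,T]`**:
`E(u T) + ν∫₀ᵀ∫|∇u|²_F = E(u 0)` — no anomalous dissipation at a Type-I first blow-up time
(Leslie–Shvydkoy 2018 Thm. 1.2 / Cheskidov–Luo 2020 Cor. 1.2, in the tree's frame;
`tendsto_eLpNorm_sub_iff_energyEquality`). [folklore] -/
theorem energyEquality_of_isTypeIBlowup {ν T : ℝ} (hν : 0 < ν) (hT : 0 < T)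
    {u : ℝ → EuclideanSpace ℝ (Fin 3) → EuclideanSpace ℝ (Fin 3)} {p : ℝ → EuclideanSpace ℝ (Fin 3) → ℝ}
    (hcl : IsClassicalNSSolutionOn (Ico 0 T) ν 0 u p) (hLH : IsLerayHopfOn T ν 0 (u 0) u)
    (hdec : HasRapidSpatialDecay (u 0)) (hTI : IsTypeIBlowup u T) :
    VectorCalculus.kineticEnergy (u T) +
      ν * (∫⁻ τ in Ioo 0 T, ∫⁻ x, ENNReal.ofReal (frobeniusNormSq (fderiv ℝ (u τ) x))).toReal =
      VectorCalculus.kineticEnergy (u 0) :=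
  (tendsto_eLpNorm_sub_iff_energyEquality hν hT hcl hLH).1
    (tendsto_eLpNorm_sub_of_isTypeIBlowup hν hT hcl hLH hdec hTI)

end NoTerminalJolt

end Summit.NavierStokesRegularity.NavierStokesRegularity.Theorems

end
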